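import Literature.NumberTheory.ConnesConsani2024.ProlateWaveCyclicPairs
import HarnessLib

/-!
# Connes–Consani–Moscovici 2024, §2.1 «Spectral triple of a cyclic pair»: proofs companion (eq. (9), Prop. 2.2, Prop. 2.3)

RH-FREE corpus literature (orthogonal-polynomial bookkeeping of an abstract cyclic pair `(D, ξ)`;
sequel material with no leaf role; nothing here bears on the truth of RH).  WHAT THIS IS NOT: any
claim about RH.  Theorems only (no `def`, no new named fact); companion of
`ProlateWaveCyclicPairs.lean` (the §2–§3 statement module, seat cc-t12), whose vocabulary
(`IsCyclicPair`, `IsIterateSeq`, `krylovSpan` = `E_n`, `cyclicBasis` = `ξ_n` (Gram–Schmidt of the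
`Dʲξ`), `cyclicBasisDom`, `jacobiCoeff` = `a_n`, `IsZ2Grading`, `IsEvenCyclicPair`, `funcCalcN` =
`f(N)`, `commutatorOp` = `[D, f]`, `spectralPhi` = `φ`) is used throughout and never restated.

## What is proved (printed proof, p. 6–8 of arXiv:2310.18423v2 = Ann. Funct. Anal. 15 (2024) §2)

* §2 p. 6, "the vectors `Dʲξ` are linearly independent" (because `dim H = ∞` and `ξ` is cyclic):
  `IsCyclicPair.linearIndependent_iterate` — a finite dependence would put every iterate in a
  finite-dimensional, hence closed, `D`-stable span `span{Dʲξ : j < N}`, which is dense.  Hence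
  `(ξ_n)` is orthonormal (`IsCyclicPair.orthonormal_cyclicBasis`), `E_n = span{ξ_0,…,ξ_n}`
  (`krylovSpan_eq_span_cyclicBasis`), `ξ_n ⊥ E_m` for `m < n`.
* `D = D*` is symmetric on `Dom D` (`IsCyclicPair.inner_map_left`, from Mathlib's
  `LinearPMap.adjoint_isFormalAdjoint`).
* **The three-term recurrence, general form** (p. 7, "One has `Dξ_j ∈ E_{j+1}` for all `j` and
  `⟨Dξ_n | ξ_k⟩ = 0` for `k < n − 1` using `D = D*`"): for EVERY cyclic pair
  `D ξ_{n+1} = a_n ξ_n + b_{n+1} ξ_{n+1} + a_{n+1} ξ_{n+2}`, `D ξ_0 = b_0 ξ_0 + a_0 ξ_1`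
  (`IsCyclicPair.map_cyclicBasisDom_succ/_zero`) with `a_n = ⟨Dξ_n | ξ_{n+1}⟩ = ‖g_{n+1}‖/‖g_n‖ > 0`
  real (`IsCyclicPair.jacobiCoeff_eq`, `jacobiCoeff_re_pos`; the Gram–Schmidt phases are the printed
  ones) and the DIAGONAL coefficient `b_n = ⟨ξ_n | Dξ_n⟩ ∈ ℝ` (`conj_inner_cyclicBasis_map_self`).
* **Eq. (9) as printed holds for EVEN cyclic pairs** — the standing hypothesis of §2.1, first line
  of the subsection (p. 7, p0006:L38: "Let `(D, ξ)` be an even cyclic pair and `γ` the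
  `ℤ/2`-grading"): `γ g_n = (−1)ⁿ g_n` (`IsZ2Grading.apply_gramSchmidt`, the sentence "the
  Gram–Schmidt orthonormalization process thus takes place independently in `E_n^±`" of the proof of
  Prop. 2.1), so `γ ξ_n = (−1)ⁿ ξ_n` (`IsZ2Grading.apply_cyclicBasis`, i.e. `γ = exp(iπN)`) and
  `b_n = 0` (`IsZ2Grading.inner_cyclicBasis_map_self`), whence `CCM2024_eq_9_of_even`: the body of the
  named fact `CCM2024_eq_9` under the hypothesis `IsEvenCyclicPair D ξ`.
  FAITHFULNESS NOTE on `CCM2024_eq_9` (typed in `ProlateWaveCyclicPairs.lean` for ALL cyclic pairs,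
  without the diagonal term): that transcription drops the standing evenness hypothesis of §2.1 and is
  not provable as typed — for a cyclic pair whose spectral measure is not symmetric one has
  `b_0 = ⟨Dξ | ξ⟩ = ∫ s dμ ≠ 0` in general, contradicting its clause `D ξ_0 = a_0 ξ_1`.  The corrected
  statement is `CCM2024_eq_9_of_even` (new name; the old `def` is left untouched for its owner).
* **Proposition 2.2** (discharge of the named fact): `CCM2024_prop_2_2_holds : CCM2024_prop_2_2`.
  For a GENERAL cyclic pair the real diagonal coefficients cancel in `[D, f(N)]` because `f(N)` is
  diagonal in `(ξ_j)`, so the printed finite-rank formula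
  `[D, f] = Σ_j (f(j) − f(j+1)) a_j (|ξ_{j+1}⟩⟨ξ_j| − |ξ_j⟩⟨ξ_{j+1}|)` holds as typed
  (`IsCyclicPair.map_funcCalcN_sub`); eq. (10): `⟨ξ_{k+1} | [D,f] ξ_k⟩ = α_k` gives the lower bound
  (`norm_coeff_le_norm_commutatorOp`), and the block-diagonal even/odd splitting with Pythagoras +
  Bessel gives `‖[D,f]‖ ≤ max_{j even}|α_j| + max_{j odd}|α_j| ≤ 2 max|α_j|` (`norm_commutatorOp_le`).
* **Proposition 2.3, corrected indexing** (`CCM2024_prop_2_3_corrected`): with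
  `φ̃(n) := Σ_{0 ≤ j < n} a_j⁻¹` (`= spectralPhi a (n − 1)`, `φ̃(0) = 0`) and `d̃(n,m) = |φ̃(n) − φ̃(m)|`,
  `½ d̃(n,m) ≤ sup{|f(n) − f(m)| : f ∈ c_c(ℕ), ‖[D,f]‖ ≤ 1} ≤ d̃(n,m)` for every cyclic pair
  (telescoping + eq. (10), the printed proof).
  FAITHFULNESS NOTE on Prop. 2.3 / eq. (11) AS PRINTED (and as typed verbatim in the named fact
  `CCM2024_prop_2_3`, with `φ(n) = Σ_{0 ≤ j ≤ n} a_j⁻¹ = φ̃(n+1)`): the print carries an index slip —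
  its own proof computes `sup{|f(n) − f(m)| : max|(f(j) − f(j+1)) a_j| ≤ 1} = Σ_{m ≤ j < n} a_j⁻¹ =
  φ(n−1) − φ(m−1)`, not `φ(n) − φ(m)`; for the archimedean pair of §3 (`a_n = |α_n| =
  ½√((2n+1)(2n+2))`, increasing) the test sequence `f = c·δ_0` has `‖[D,f]‖ = |c| a_0`, so the
  spectral distance of `0` and `1` is `≥ 1/a_0 = √2 > 1/a_1 = d(1,0)`, violating the printed upper
  bound.  The corrected statement is proved under a new name; the old `def` is left untouched.

Source: A. Connes, C. Consani, H. Moscovici, *Zeta zeros and prolate wave operators*, Ann. Funct.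
Anal. 15 (2024) no. 4, 87 = arXiv:2310.18423, §2–§2.1, pp. 6–8 (Thm. 2.1, Prop. 2.1, eq. (9),
Prop. 2.2 with eq. (10), Prop. 2.3 with eq. (11)); held text `paper:arxiv-2310.18423`, locators
`p0006:L3–L49`, `p0007:L8–L60`. [bib: `ConnesConsaniMoscovici2024`]
-/

noncomputable section

open _root_.MeasureTheory Complex InnerProductSpace Submodule
open scoped InnerProductSpace ComplexConjugate

namespace Literature.NumberTheory.ConnesConsani2024

section General

variable {H : Type*} [NormedAddCommGroup H] [InnerProductSpace ℂ H] [CompleteSpace H]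
variable {D : H →ₗ.[ℂ] H} {ξ : H} {v : ℕ → D.domain}

/-- `D = D*` is symmetric on its domain. [cite: ConnesConsaniMoscovici2024, §2 p. 6 (p0006:L3) & §2.1 p. 7 (p0006:L47)] -/
theorem IsCyclicPair.inner_map_left (hD : IsCyclicPair D ξ) (x y : D.domain) :
    ⟪(D x : H), (y : H)⟫_ℂ = ⟪(x : H), (D y : H)⟫_ℂ := by
  have h : D.adjoint = D := LinearPMap.isSelfAdjoint_def.mp hD.isSelfAdjoint
  obtain ⟨hdom, happ⟩ := LinearPMap.ext_iff.mp h
  have hx : (x : H) ∈ D.adjoint.domain := by rw [hdom]; exact x.2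
  have h1 := LinearPMap.adjoint_isFormalAdjoint hD.isSelfAdjoint.dense_domain ⟨x, hx⟩ y
  rw [happ (hf := hx) (hg := x.2)] at h1
  simpa using h1

/-- Symmetric form of `inner_map_left`. [cite: ConnesConsaniMoscovici2024, §2.1 p. 7 (p0006:L47)] -/
theorem IsCyclicPair.inner_map_right (hD : IsCyclicPair D ξ) (x y : D.domain) :
    ⟪(x : H), (D y : H)⟫_ℂ = ⟪(D x : H), (y : H)⟫_ℂ :=
  (hD.inner_map_left x y).symm

omit [CompleteSpace H] in
/-- The span of the `v j`, `j < N`, lies in `Dom D`. [folklore] -/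
private theorem span_iterate_Iio_le_domain (v : ℕ → D.domain) (N : ℕ) :
    span ℂ ((fun j => (v j : H)) '' Set.Iio N) ≤ D.domain := by
  refine span_le.mpr ?_
  rintro _ ⟨j, -, rfl⟩
  exact (v j).2

/-- The iterates `Dʲ ξ` of a cyclic pair are linearly independent (§2 p. 6: "the vectors `Dʲξ` are
linearly independent", because `H` is infinite dimensional and `ξ` is cyclic). [cite: ConnesConsaniMoscovici2024, §2 p. 6 (p0006:L5)] -/
theorem IsCyclicPair.linearIndependent_iterate (hD : IsCyclicPair D ξ) (hv : IsIterateSeq D ξ v) :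
    LinearIndependent ℂ (fun j => (v j : H)) := by
  classical
  rw [linearIndependent_iff']
  intro s g hsum
  by_contra hne
  push Not at hne
  obtain ⟨i₀, hi₀s, hgi₀⟩ := hne
  set T : Finset ℕ := s.filter (fun i => g i ≠ 0) with hT
  have hTne : T.Nonempty := ⟨i₀, Finset.mem_filter.mpr ⟨hi₀s, hgi₀⟩⟩
  set N := T.max' hTne with hN
  have hNT : N ∈ T := Finset.max'_mem T hTne
  have hgN : g N ≠ 0 := (Finset.mem_filter.mp hNT).2
  have hNs : N ∈ s := (Finset.mem_filter.mp hNT).1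
  have hzero : ∀ i ∈ s, N < i → g i = 0 := by
    intro i hi hlt
    by_contra hgi
    have : i ≤ N := Finset.le_max' T i (Finset.mem_filter.mpr ⟨hi, hgi⟩)
    omega
  set F : Submodule ℂ H := span ℂ ((fun j => (v j : H)) '' Set.Iio N) with hF
  have hFdom : F ≤ D.domain := span_iterate_Iio_le_domain v N
  -- `v N ∈ F`
  have hvN : (v N : H) ∈ F := by
    have hsplit := Finset.sum_erase_add s (fun i => g i • (v i : H)) hNs
    rw [hsum] at hsplit
    have hrest : ∑ i ∈ s.erase N, g i • (v i : H) ∈ F := by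
      refine Submodule.sum_mem _ fun i hi => ?_
      rcases lt_or_gt_of_ne (Finset.ne_of_mem_erase hi) with hlt | hgt
      · exact Submodule.smul_mem _ _ (subset_span ⟨i, hlt, rfl⟩)
      · rw [hzero i (Finset.mem_of_mem_erase hi) hgt, zero_smul]; exact zero_mem _
    have hgv : g N • (v N : H) = -∑ i ∈ s.erase N, g i • (v i : H) :=
      eq_neg_of_add_eq_zero_right hsplit
    have : (v N : H) = (g N)⁻¹ • (-∑ i ∈ s.erase N, g i • (v i : H)) := by
      rw [← hgv, smul_smul, inv_mul_cancel₀ hgN, one_smul]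
    rw [this]
    exact Submodule.smul_mem _ _ (neg_mem hrest)
  -- `F` is stable under `D`
  have hstable : ∀ x ∈ F, ∀ hx : x ∈ D.domain, (D ⟨x, hx⟩ : H) ∈ F := by
    intro x hx
    induction hx using span_induction with
    | mem y hy =>
      obtain ⟨j, hj, rfl⟩ := hy
      intro hx
      have heq : (⟨(v j : H), hx⟩ : D.domain) = v j := rfl
      rw [heq, ← hv.2 j]
      have hj' : j < N := hj
      rcases Nat.lt_or_ge (j + 1) N with hlt | hge
      · exact subset_span ⟨j + 1, hlt, rfl⟩
      · have : j + 1 = N := le_antisymm (Nat.succ_le_of_lt hj') hge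
        rw [this]; exact hvN
    | zero =>
      intro hx
      have heq : (⟨(0 : H), hx⟩ : D.domain) = 0 := rfl
      rw [heq, LinearPMap.map_zero]; exact zero_mem _
    | add y z hy hz ihy ihz =>
      intro hx
      have hyD : y ∈ D.domain := hFdom hy
      have hzD : z ∈ D.domain := hFdom hz
      have heq : (⟨y + z, hx⟩ : D.domain) = ⟨y, hyD⟩ + ⟨z, hzD⟩ := rfl
      rw [heq, LinearPMap.map_add]
      exact add_mem (ihy hyD) (ihz hzD)
    | smul a y hy ihy =>
      intro hx
      have hyD : y ∈ D.domain := hFdom hy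
      have heq : (⟨a • y, hx⟩ : D.domain) = a • ⟨y, hyD⟩ := rfl
      rw [heq, LinearPMap.map_smul]
      exact smul_mem _ _ (ihy hyD)
  -- hence every iterate lies in `F`
  have hall : ∀ j, (v j : H) ∈ F := by
    intro j
    induction j with
    | zero =>
      rcases Nat.eq_zero_or_pos N with h0 | hpos
      · have : (v 0 : H) = v N := by rw [h0]
        rw [this]; exact hvN
      · exact subset_span ⟨0, hpos, rfl⟩
    | succ j ih =>
      have := hstable (v j) ih (v j).2
      rw [hv.2 j]
      simpa using this
  -- so `F` is dense; being finite dimensional it is closed, hence everything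
  obtain ⟨w, hw, hdense⟩ := hD.exists_iterateSeq_dense
  have hwv : w = v := hw.unique hv
  subst hwv
  have hle : span ℂ (Set.range fun j => (w j : H)) ≤ F := span_le.mpr (by
    rintro _ ⟨j, rfl⟩; exact hall j)
  have hFdense : Dense (F : Set H) := hdense.mono hle
  haveI : FiniteDimensional ℂ F :=
    FiniteDimensional.span_of_finite ℂ ((Set.finite_Iio N).image _)
  have hFclosed : IsClosed (F : Set H) := Submodule.closed_of_finiteDimensional F
  have hFtop : F = ⊤ := by
    refine Submodule.eq_top_iff'.mpr fun x => ?_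
    have hx : x ∈ closure (F : Set H) := by rw [hFdense.closure_eq]; exact Set.mem_univ x
    rwa [hFclosed.closure_eq] at hx
  have hfin : FiniteDimensional ℂ H := by
    have : FiniteDimensional ℂ (⊤ : Submodule ℂ H) := by rw [← hFtop]; infer_instance
    exact LinearEquiv.finiteDimensional (Submodule.topEquiv : (⊤ : Submodule ℂ H) ≃ₗ[ℂ] H)
  exact hD.not_finiteDimensional hfin

/-- The Gram–Schmidt vectors `g_n` of the iterates are non-zero. [cite: ConnesConsaniMoscovici2024, §2 p. 6 (p0006:L14)] -/
theorem IsCyclicPair.gramSchmidt_ne_zero (hD : IsCyclicPair D ξ) (hv : IsIterateSeq D ξ v)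
    (n : ℕ) : gramSchmidt ℂ (fun j => (v j : H)) n ≠ 0 :=
  InnerProductSpace.gramSchmidt_ne_zero n (hD.linearIndependent_iterate hv)

/-- The basis `(ξ_j)` of a cyclic pair is orthonormal (§2 p. 6). [cite: ConnesConsaniMoscovici2024, §2 p. 6 (p0006:L14)] -/
theorem IsCyclicPair.orthonormal_cyclicBasis (hD : IsCyclicPair D ξ) (hv : IsIterateSeq D ξ v) :
    Orthonormal ℂ (cyclicBasis v) :=
  gramSchmidtNormed_orthonormal (hD.linearIndependent_iterate hv)

/-- `‖ξ_n‖ = 1`. [cite: ConnesConsaniMoscovici2024, §2 p. 6 (p0006:L14)] -/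
theorem IsCyclicPair.norm_cyclicBasis (hD : IsCyclicPair D ξ) (hv : IsIterateSeq D ξ v) (n : ℕ) :
    ‖cyclicBasis v n‖ = 1 :=
  (hD.orthonormal_cyclicBasis hv).1 n

omit [CompleteSpace H] in
/-- `E_n = span{ξ_0, …, ξ_n}` (§2 p. 6: "`E_n` is the span of the `ξ_j` for `j ≤ n`"). [cite: ConnesConsaniMoscovici2024, §2 p. 6 (p0006:L14)] -/
theorem krylovSpan_eq_span_cyclicBasis (v : ℕ → D.domain) (n : ℕ) :
    krylovSpan v n = span ℂ (cyclicBasis v '' Set.Iic n) := by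
  have h1 := span_gramSchmidtNormed (𝕜 := ℂ) (fun j => (v j : H)) (Set.Iic n)
  have h2 := span_gramSchmidt_Iic ℂ (fun j => (v j : H)) n
  unfold cyclicBasis krylovSpan
  rw [h1, h2]

/-- `ξ_n ⊥ E_m` for `m < n`. [cite: ConnesConsaniMoscovici2024, §2 p. 6 (p0006:L14)] -/
theorem IsCyclicPair.inner_cyclicBasis_eq_zero_of_mem_krylovSpan (hD : IsCyclicPair D ξ)
    (hv : IsIterateSeq D ξ v) {m n : ℕ} (hmn : m < n) {x : H} (hx : x ∈ krylovSpan v m) :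
    ⟪cyclicBasis v n, x⟫_ℂ = 0 := by
  rw [krylovSpan_eq_span_cyclicBasis] at hx
  induction hx using span_induction with
  | mem y hy =>
    obtain ⟨j, hj, rfl⟩ := hy
    have hj' : j ≤ m := hj
    exact (hD.orthonormal_cyclicBasis hv).2 (by omega)
  | zero => exact inner_zero_right _
  | add y z _ _ hy hz => rw [inner_add_right, hy, hz, add_zero]
  | smul a y _ hy => rw [inner_smul_right, hy, mul_zero]

/-- Expansion of a vector of `E_N` in the orthonormal basis `ξ_0, …, ξ_N`. [cite: ConnesConsaniMoscovici2024, §2 p. 6 (p0006:L14)] -/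
theorem IsCyclicPair.sum_inner_smul_cyclicBasis (hD : IsCyclicPair D ξ) (hv : IsIterateSeq D ξ v)
    {N : ℕ} {x : H} (hx : x ∈ krylovSpan v N) :
    ∑ j ∈ Finset.range (N + 1), ⟪cyclicBasis v j, x⟫_ℂ • cyclicBasis v j = x := by
  classical
  rw [krylovSpan_eq_span_cyclicBasis] at hx
  induction hx using span_induction with
  | mem y hy =>
    obtain ⟨i, hi, rfl⟩ := hy
    have hi' : i ∈ Finset.range (N + 1) := Finset.mem_range.mpr (Nat.lt_succ_of_le hi)
    have hite := orthonormal_iff_ite.mp (hD.orthonormal_cyclicBasis hv)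
    simp_rw [hite, ite_smul, one_smul, zero_smul]
    rw [Finset.sum_ite_eq' (Finset.range (N + 1)) i (cyclicBasis v), if_pos hi']
  | zero => simp
  | add y z _ _ hy hz =>
    simp_rw [inner_add_right, add_smul, Finset.sum_add_distrib]
    rw [hy, hz]
  | smul a y _ hy =>
    simp_rw [inner_smul_right, mul_smul, ← Finset.smul_sum]
    rw [hy]


/-! ### The Jacobi matrix of `D` in the basis `(ξ_n)` -/

omit [CompleteSpace H] in
/-- `D ξ_n ∈ E_{n+1}` (p. 7: "One has `Dξ_j ∈ E_{j+1}` for all `j`"). [cite: ConnesConsaniMoscovici2024, §2.1 p. 7 (p0006:L47)] -/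
theorem IsIterateSeq.map_cyclicBasisDom_mem (hv : IsIterateSeq D ξ v) (n : ℕ) :
    D (cyclicBasisDom v n) ∈ krylovSpan v (n + 1) :=
  hv.apply_mem_krylovSpan_succ (cyclicBasisDom v n) (cyclicBasis_mem_krylovSpan v n)

/-- `⟪ξ_k, D ξ_n⟫ = 0` for `n + 1 < k`. [cite: ConnesConsaniMoscovici2024, §2.1 p. 7 (p0006:L47)] -/
theorem IsCyclicPair.inner_cyclicBasis_map_eq_zero_of_lt (hD : IsCyclicPair D ξ)
    (hv : IsIterateSeq D ξ v) {n k : ℕ} (h : n + 1 < k) :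
    ⟪cyclicBasis v k, D (cyclicBasisDom v n)⟫_ℂ = 0 :=
  hD.inner_cyclicBasis_eq_zero_of_mem_krylovSpan hv h (hv.map_cyclicBasisDom_mem n)

/-- `⟪ξ_k, D ξ_n⟫ = 0` for `k + 1 < n` (p. 7: "`⟨Dξ_n | ξ_k⟩ = 0` for `k < n − 1` using `D = D*`"). [cite: ConnesConsaniMoscovici2024, §2.1 p. 7 (p0006:L47)] -/
theorem IsCyclicPair.inner_cyclicBasis_map_eq_zero_of_gt (hD : IsCyclicPair D ξ)
    (hv : IsIterateSeq D ξ v) {n k : ℕ} (h : k + 1 < n) :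
    ⟪cyclicBasis v k, D (cyclicBasisDom v n)⟫_ℂ = 0 := by
  have h0 : ⟪cyclicBasis v n, D (cyclicBasisDom v k)⟫_ℂ = 0 :=
    hD.inner_cyclicBasis_map_eq_zero_of_lt hv h
  have h1 : ⟪cyclicBasis v k, D (cyclicBasisDom v n)⟫_ℂ =
      ⟪(D (cyclicBasisDom v k) : H), cyclicBasis v n⟫_ℂ :=
    hD.inner_map_right (cyclicBasisDom v k) (cyclicBasisDom v n)
  rw [h1, ← inner_conj_symm, h0, map_zero]

/-- The diagonal coefficient `b_n = ⟪ξ_n, D ξ_n⟫` is real. [cite: ConnesConsaniMoscovici2024, §2.1 p. 7 (p0006:L47)] -/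
theorem IsCyclicPair.conj_inner_cyclicBasis_map_self (hD : IsCyclicPair D ξ) (n : ℕ) :
    conj ⟪cyclicBasis v n, D (cyclicBasisDom v n)⟫_ℂ = ⟪cyclicBasis v n, D (cyclicBasisDom v n)⟫_ℂ := by
  rw [inner_conj_symm]
  exact hD.inner_map_left (cyclicBasisDom v n) (cyclicBasisDom v n)

omit [CompleteSpace H] in
/-- The Gram–Schmidt vector `g_n` of the iterates lies in `E_n`. [folklore] -/
private theorem gramSchmidt_iterate_mem_krylovSpan (v : ℕ → D.domain) (n : ℕ) :
    gramSchmidt ℂ (fun j => (v j : H)) n ∈ krylovSpan v n :=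
  InnerProductSpace.gramSchmidt_mem_span ℂ _ le_rfl

omit [CompleteSpace H] in
/-- `v_n − g_n` lies in the span of the `v_j`, `j < n`. [folklore] -/
private theorem iterate_sub_gramSchmidt_mem (v : ℕ → D.domain) (n : ℕ) :
    (v n : H) - gramSchmidt ℂ (fun j => (v j : H)) n ∈
      span ℂ ((fun j => (v j : H)) '' Set.Iio n) := by
  rw [gramSchmidt_def ℂ (fun j => (v j : H)) n, sub_sub_cancel,
    ← span_gramSchmidt_Iio ℂ (fun j => (v j : H)) n]
  refine Submodule.sum_mem _ fun i hi => ?_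
  have hi' : i < n := Finset.mem_Iio.mp hi
  have hmem : (ℂ ∙ gramSchmidt ℂ (fun j => (v j : H)) i).starProjection (v n : H) ∈
      ℂ ∙ gramSchmidt ℂ (fun j => (v j : H)) i := Submodule.starProjection_apply_mem _ _
  have hsub : ({gramSchmidt ℂ (fun j => (v j : H)) i} : Set H) ⊆
      gramSchmidt ℂ (fun j => (v j : H)) '' Set.Iio n :=
    Set.singleton_subset_iff.mpr ⟨i, hi', rfl⟩
  exact span_mono hsub hmem

omit [CompleteSpace H] in
/-- `v_{n+1} − g_{n+1} ∈ E_n`. [folklore] -/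
private theorem iterate_succ_sub_gramSchmidt_mem_krylovSpan (v : ℕ → D.domain) (n : ℕ) :
    (v (n + 1) : H) - gramSchmidt ℂ (fun j => (v j : H)) (n + 1) ∈ krylovSpan v n := by
  have h := iterate_sub_gramSchmidt_mem v (n + 1)
  have hI : Set.Iio (n + 1) = Set.Iic n := by
    ext j; simp
  rw [hI] at h
  exact h

omit [CompleteSpace H] in
/-- `g_0 = v_0`. [folklore] -/
private theorem gramSchmidt_iterate_zero (v : ℕ → D.domain) :
    gramSchmidt ℂ (fun j => (v j : H)) 0 = (v 0 : H) := by
  rw [gramSchmidt_def]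
  simp

omit [CompleteSpace H] in
/-- The Gram–Schmidt vector `g_n` lies in `Dom D`. [folklore] -/
private theorem gramSchmidt_iterate_mem_domain (v : ℕ → D.domain) (n : ℕ) :
    gramSchmidt ℂ (fun j => (v j : H)) n ∈ D.domain :=
  krylovSpan_le_domain v n (gramSchmidt_iterate_mem_krylovSpan v n)

omit [CompleteSpace H] in
/-- `ξ_n = ‖g_n‖⁻¹ g_n` inside `Dom D`. [folklore] -/
private theorem cyclicBasisDom_eq_smul_gramSchmidt (v : ℕ → D.domain) (n : ℕ) :
    cyclicBasisDom v n = ((‖gramSchmidt ℂ (fun j => (v j : H)) n‖ : ℂ))⁻¹ •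
      (⟨gramSchmidt ℂ (fun j => (v j : H)) n, gramSchmidt_iterate_mem_domain v n⟩ : D.domain) :=
  Subtype.ext rfl

/-- `⟪ξ_{n+1}, D g_n⟫ = ⟪ξ_{n+1}, v_{n+1}⟫`: `D g_n ≡ v_{n+1}` modulo `E_n`. [folklore] -/
private theorem IsCyclicPair.inner_cyclicBasis_succ_map_gramSchmidt (hD : IsCyclicPair D ξ)
    (hv : IsIterateSeq D ξ v) (n : ℕ) :
    ⟪cyclicBasis v (n + 1),
        D ⟨gramSchmidt ℂ (fun j => (v j : H)) n, gramSchmidt_iterate_mem_domain v n⟩⟫_ℂ =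
      ⟪cyclicBasis v (n + 1), (v (n + 1) : H)⟫_ℂ := by
  -- `D g_n = D v_n - D (v_n - g_n)` and the second term lies in `E_n`
  have hsub : (v n : H) - gramSchmidt ℂ (fun j => (v j : H)) n ∈ D.domain :=
    sub_mem (v n).2 (gramSchmidt_iterate_mem_domain v n)
  have hdec : (⟨gramSchmidt ℂ (fun j => (v j : H)) n, gramSchmidt_iterate_mem_domain v n⟩ :
      D.domain) = v n - ⟨(v n : H) - gramSchmidt ℂ (fun j => (v j : H)) n, hsub⟩ :=
    Subtype.ext (by simp)
  have hEn : (D ⟨(v n : H) - gramSchmidt ℂ (fun j => (v j : H)) n, hsub⟩ : H) ∈ krylovSpan v n := by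
    cases n with
    | zero =>
      have h0 : (⟨(v 0 : H) - gramSchmidt ℂ (fun j => (v j : H)) 0, hsub⟩ : D.domain) = 0 :=
        Subtype.ext (by simp [gramSchmidt_iterate_zero])
      rw [h0, LinearPMap.map_zero]; exact zero_mem _
    | succ m =>
      exact hv.apply_mem_krylovSpan_succ _ (iterate_succ_sub_gramSchmidt_mem_krylovSpan v m)
  rw [hdec, LinearPMap.map_sub, inner_sub_right, ← hv.2 n,
    hD.inner_cyclicBasis_eq_zero_of_mem_krylovSpan hv (Nat.lt_succ_self n) hEn, sub_zero]

/-- `⟪ξ_{n+1}, v_{n+1}⟫ = ‖g_{n+1}‖`. [folklore] -/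
private theorem IsCyclicPair.inner_cyclicBasis_succ_iterate (hD : IsCyclicPair D ξ)
    (hv : IsIterateSeq D ξ v) (n : ℕ) :
    ⟪cyclicBasis v (n + 1), (v (n + 1) : H)⟫_ℂ = (‖gramSchmidt ℂ (fun j => (v j : H)) (n + 1)‖ : ℂ) := by
  set g := gramSchmidt ℂ (fun j => (v j : H)) with hg
  have hsplit : (v (n + 1) : H) = g (n + 1) + ((v (n + 1) : H) - g (n + 1)) := by abel
  rw [hsplit, inner_add_right,
    hD.inner_cyclicBasis_eq_zero_of_mem_krylovSpan hv (Nat.lt_succ_self n)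
      (iterate_succ_sub_gramSchmidt_mem_krylovSpan v n), add_zero]
  have hξ : cyclicBasis v (n + 1) = ((‖g (n + 1)‖ : ℂ))⁻¹ • g (n + 1) := rfl
  have hgg : ⟪g (n + 1), g (n + 1)⟫_ℂ = (‖g (n + 1)‖ : ℂ) * (‖g (n + 1)‖ : ℂ) := by
    rw [inner_self_eq_norm_sq_to_K, sq]; rfl
  rw [hξ, inner_smul_left, hgg, map_inv₀, Complex.conj_ofReal]
  have hne : (‖g (n + 1)‖ : ℂ) ≠ 0 := by
    rw [Ne, Complex.ofReal_eq_zero, norm_eq_zero]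
    exact hD.gramSchmidt_ne_zero hv (n + 1)
  rw [← mul_assoc, inv_mul_cancel₀ hne, one_mul]

/-- The Jacobi coefficient `a_n = ⟪D ξ_n | ξ_{n+1}⟩` equals `‖g_{n+1}‖ / ‖g_n‖` (p. 7: "one can fix by
induction the phase of the orthonormal vectors `ξ_n` in such a way that the non-zero scalars
`a_n := ⟨Dξ_n | ξ_{n+1}⟩` are positive" — the Gram–Schmidt phases do this). [cite: ConnesConsaniMoscovici2024, §2.1 eq. (9) p. 7 (p0006:L49)] -/
theorem IsCyclicPair.jacobiCoeff_eq (hD : IsCyclicPair D ξ) (hv : IsIterateSeq D ξ v) (n : ℕ) :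
    jacobiCoeff v n = ((‖gramSchmidt ℂ (fun j => (v j : H)) (n + 1)‖ /
      ‖gramSchmidt ℂ (fun j => (v j : H)) n‖ : ℝ) : ℂ) := by
  set g := gramSchmidt ℂ (fun j => (v j : H)) with hg
  have h1 : ⟪cyclicBasis v (n + 1), D (cyclicBasisDom v n)⟫_ℂ =
      ((‖g n‖ : ℂ))⁻¹ * (‖g (n + 1)‖ : ℂ) := by
    rw [cyclicBasisDom_eq_smul_gramSchmidt, LinearPMap.map_smul, inner_smul_right,
      hD.inner_cyclicBasis_succ_map_gramSchmidt hv n, hD.inner_cyclicBasis_succ_iterate hv n]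
  unfold jacobiCoeff
  rw [← inner_conj_symm, h1, map_mul, map_inv₀, Complex.conj_ofReal, Complex.conj_ofReal,
    Complex.ofReal_div]
  ring

/-- `a_n > 0` (as a real number; `a_n` is real). [cite: ConnesConsaniMoscovici2024, §2.1 eq. (9) p. 7 (p0006:L49)] -/
theorem IsCyclicPair.jacobiCoeff_re_pos (hD : IsCyclicPair D ξ) (hv : IsIterateSeq D ξ v) (n : ℕ) :
    (((jacobiCoeff v n).re : ℝ) : ℂ) = jacobiCoeff v n ∧ 0 < (jacobiCoeff v n).re := by
  rw [hD.jacobiCoeff_eq hv n, Complex.ofReal_re]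
  refine ⟨rfl, div_pos ?_ ?_⟩ <;>
    exact norm_pos_iff.mpr (hD.gramSchmidt_ne_zero hv _)

/-- `conj a_n = a_n`. [cite: ConnesConsaniMoscovici2024, §2.1 eq. (9) p. 7 (p0006:L49)] -/
theorem IsCyclicPair.conj_jacobiCoeff (hD : IsCyclicPair D ξ) (hv : IsIterateSeq D ξ v) (n : ℕ) :
    conj (jacobiCoeff v n) = jacobiCoeff v n := by
  rw [hD.jacobiCoeff_eq hv n, Complex.conj_ofReal]

/-- `⟪ξ_n, D ξ_{n+1}⟫ = a_n`. [cite: ConnesConsaniMoscovici2024, §2.1 eq. (9) p. 7 (p0006:L49)] -/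
theorem IsCyclicPair.inner_cyclicBasis_map_succ (hD : IsCyclicPair D ξ)
    (n : ℕ) : ⟪cyclicBasis v n, D (cyclicBasisDom v (n + 1))⟫_ℂ = jacobiCoeff v n := by
  unfold jacobiCoeff
  exact hD.inner_map_right (cyclicBasisDom v n) (cyclicBasisDom v (n + 1))

/-- `⟪ξ_{n+1}, D ξ_n⟫ = a_n`. [cite: ConnesConsaniMoscovici2024, §2.1 eq. (9) p. 7 (p0006:L49)] -/
theorem IsCyclicPair.inner_cyclicBasis_succ_map (hD : IsCyclicPair D ξ) (hv : IsIterateSeq D ξ v)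
    (n : ℕ) : ⟪cyclicBasis v (n + 1), D (cyclicBasisDom v n)⟫_ℂ = jacobiCoeff v n := by
  rw [← hD.conj_jacobiCoeff hv n]
  unfold jacobiCoeff
  rw [inner_conj_symm]

/-- RH-FREE. **General three-term recurrence** (eq. (9) with its diagonal term, valid for every
cyclic pair): `D ξ_{n+1} = a_n ξ_n + b_{n+1} ξ_{n+1} + a_{n+1} ξ_{n+2}` with `b_k = ⟪ξ_k, D ξ_k⟫ ∈ ℝ`.
For an *even* cyclic pair `b_k = 0` (`CCM2024_eq_9_of_even`).
[cite: ConnesConsaniMoscovici2024, §2.1 eq. (9) p. 7 (p0006:L49)] -/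
theorem IsCyclicPair.map_cyclicBasisDom_succ (hD : IsCyclicPair D ξ) (hv : IsIterateSeq D ξ v)
    (n : ℕ) :
    D (cyclicBasisDom v (n + 1)) =
      jacobiCoeff v n • cyclicBasis v n
        + ⟪cyclicBasis v (n + 1), D (cyclicBasisDom v (n + 1))⟫_ℂ • cyclicBasis v (n + 1)
        + jacobiCoeff v (n + 1) • cyclicBasis v (n + 2) := by
  have hexp := hD.sum_inner_smul_cyclicBasis hv (hv.map_cyclicBasisDom_mem (n + 1))
  have h3 : ∑ j ∈ Finset.range n,
      ⟪cyclicBasis v j, D (cyclicBasisDom v (n + 1))⟫_ℂ • cyclicBasis v j = 0 := by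
    refine Finset.sum_eq_zero fun j hj => ?_
    have hj' : j < n := Finset.mem_range.mp hj
    rw [hD.inner_cyclicBasis_map_eq_zero_of_gt hv (by omega), zero_smul]
  conv_lhs => rw [← hexp]
  rw [Finset.sum_range_succ, Finset.sum_range_succ, Finset.sum_range_succ, h3, zero_add,
    hD.inner_cyclicBasis_map_succ n, hD.inner_cyclicBasis_succ_map hv (n + 1)]

/-- RH-FREE. The recurrence at `n = 0`: `D ξ_0 = b_0 ξ_0 + a_0 ξ_1`.
[cite: ConnesConsaniMoscovici2024, §2.1 eq. (9) p. 7 (p0006:L49)] -/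
theorem IsCyclicPair.map_cyclicBasisDom_zero (hD : IsCyclicPair D ξ) (hv : IsIterateSeq D ξ v) :
    D (cyclicBasisDom v 0) =
      ⟪cyclicBasis v 0, D (cyclicBasisDom v 0)⟫_ℂ • cyclicBasis v 0
        + jacobiCoeff v 0 • cyclicBasis v 1 := by
  have hexp := hD.sum_inner_smul_cyclicBasis hv (hv.map_cyclicBasisDom_mem 0)
  conv_lhs => rw [← hexp]
  rw [Finset.sum_range_succ, Finset.sum_range_succ, Finset.sum_range_zero, zero_add,
    hD.inner_cyclicBasis_succ_map hv 0]

end General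

/-! ### Even cyclic pairs: `γ ξ_n = (−1)ⁿ ξ_n` and the vanishing of the diagonal -/

section Even

variable {H : Type*} [NormedAddCommGroup H] [InnerProductSpace ℂ H] [CompleteSpace H]
variable {D : H →ₗ.[ℂ] H} {ξ : H} {v : ℕ → D.domain} {γ : H →L[ℂ] H}

/-- A `ℤ/2`-grading preserves inner products (`γ` is a self-adjoint unitary). [cite: ConnesConsaniMoscovici2024, Def. 2.3 p. 6 (p0006:L23)] -/
theorem IsZ2Grading.inner_map_map (hγ : IsZ2Grading D ξ γ) (x y : H) :
    ⟪γ x, γ y⟫_ℂ = ⟪x, y⟫_ℂ := by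
  have hsym : (γ : H →ₗ[ℂ] H).IsSymmetric :=
    ContinuousLinearMap.isSelfAdjoint_iff_isSymmetric.mp hγ.isSelfAdjoint
  have h1 := hsym x (γ y)
  simp only [ContinuousLinearMap.coe_coe] at h1
  have h2 : γ (γ y) = y := by
    have h3 := congrArg (fun T : H →L[ℂ] H => T y) hγ.mul_self
    exact h3
  rw [h1, h2]

/-- `γ g_n = (−1)ⁿ g_n` for the Gram–Schmidt vectors of the iterates (proof of Prop. 2.1, p. 7:
"the Gram–Schmidt orthonormalization process thus takes place independently in `E_n^±`").
[cite: ConnesConsaniMoscovici2024, Prop. 2.1 (proof) p. 7 (p0006:L34)] -/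
theorem IsZ2Grading.apply_gramSchmidt (hγ : IsZ2Grading D ξ γ) (hv : IsIterateSeq D ξ v) (n : ℕ) :
    γ (gramSchmidt ℂ (fun j => (v j : H)) n) =
      (-1 : ℂ) ^ n • gramSchmidt ℂ (fun j => (v j : H)) n := by
  induction n using Nat.strong_induction_on with
  | _ n ih =>
    set f : ℕ → H := fun j => (v j : H) with hf
    have hfn : γ (f n) = (-1 : ℂ) ^ n • f n := hγ.apply_iterate hv n
    rw [gramSchmidt_def ℂ f n, map_sub, map_sum, smul_sub, Finset.smul_sum, hfn]
    congr 1
    refine Finset.sum_congr rfl fun i hi => ?_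
    have hi' : i < n := Finset.mem_Iio.mp hi
    have hkey : (-1 : ℂ) ^ i * ⟪gramSchmidt ℂ f i, f n⟫_ℂ =
        (-1 : ℂ) ^ n * ⟪gramSchmidt ℂ f i, f n⟫_ℂ := by
      have h1 : ⟪gramSchmidt ℂ f i, f n⟫_ℂ = ⟪γ (gramSchmidt ℂ f i), γ (f n)⟫_ℂ :=
        (hγ.inner_map_map _ _).symm
      rw [ih i hi', hfn, inner_smul_left, inner_smul_right, map_pow, map_neg, map_one] at h1
      have hsq : ((-1 : ℂ) ^ i) * ((-1 : ℂ) ^ i) = 1 := by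
        rw [← pow_add, ← two_mul, pow_mul, neg_one_sq, one_pow]
      calc (-1 : ℂ) ^ i * ⟪gramSchmidt ℂ f i, f n⟫_ℂ
          = (-1 : ℂ) ^ i * ((-1) ^ i * ((-1) ^ n * ⟪gramSchmidt ℂ f i, f n⟫_ℂ)) := by rw [← h1]
        _ = ((-1 : ℂ) ^ i * (-1) ^ i) * ((-1) ^ n * ⟪gramSchmidt ℂ f i, f n⟫_ℂ) := by ring
        _ = (-1 : ℂ) ^ n * ⟪gramSchmidt ℂ f i, f n⟫_ℂ := by rw [hsq, one_mul]
    rw [starProjection_singleton, map_smul, ih i hi', smul_smul, smul_smul]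
    congr 1
    set c : ℂ := ⟪gramSchmidt ℂ f i, f n⟫_ℂ
    set d : ℂ := ((‖gramSchmidt ℂ f i‖ ^ 2 : ℝ) : ℂ)
    calc c / d * (-1 : ℂ) ^ i = ((-1 : ℂ) ^ i * c) / d := by ring
      _ = ((-1 : ℂ) ^ n * c) / d := by rw [hkey]
      _ = (-1 : ℂ) ^ n * (c / d) := by ring

/-- `γ ξ_n = (−1)ⁿ ξ_n`, i.e. `γ = exp(iπN)` on the orthonormal basis (Prop. 2.1, last sentence).
[cite: ConnesConsaniMoscovici2024, Prop. 2.1 p. 6 (p0006:L25)] -/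
theorem IsZ2Grading.apply_cyclicBasis (hγ : IsZ2Grading D ξ γ) (hv : IsIterateSeq D ξ v) (n : ℕ) :
    γ (cyclicBasis v n) = (-1 : ℂ) ^ n • cyclicBasis v n := by
  show γ (gramSchmidtNormed ℂ (fun j => (v j : H)) n) =
    (-1 : ℂ) ^ n • gramSchmidtNormed ℂ (fun j => (v j : H)) n
  rw [gramSchmidtNormed, map_smul, hγ.apply_gramSchmidt hv n, smul_comm]

/-- For an even cyclic pair the diagonal Jacobi coefficients vanish: `⟪ξ_n, D ξ_n⟫ = 0`
(`γ D = −D γ` and `γ ξ_n = ± ξ_n`). [cite: ConnesConsaniMoscovici2024, §2.1 p. 7 (p0006:L38, L49)] -/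
theorem IsZ2Grading.inner_cyclicBasis_map_self (hγ : IsZ2Grading D ξ γ) (hv : IsIterateSeq D ξ v)
    (n : ℕ) : ⟪cyclicBasis v n, D (cyclicBasisDom v n)⟫_ℂ = 0 := by
  set x : D.domain := cyclicBasisDom v n with hxdef
  have hx : (x : H) = cyclicBasis v n := rfl
  have hγx : γ (x : H) = (-1 : ℂ) ^ n • (x : H) := by rw [hx]; exact hγ.apply_cyclicBasis hv n
  have hmem : γ (x : H) ∈ D.domain := hγ.mapsTo_domain x
  have hdom : (⟨γ (x : H), hmem⟩ : D.domain) = (-1 : ℂ) ^ n • x :=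
    Subtype.ext (by rw [Submodule.coe_smul]; exact hγx)
  have hD' : γ (D x) = -((-1 : ℂ) ^ n • D x) := by
    rw [hγ.anticomm x, hdom, LinearPMap.map_smul]
  have h := hγ.inner_map_map (x : H) (D x)
  rw [hγx, hD', inner_smul_left, inner_neg_right, inner_smul_right, map_pow, map_neg,
    map_one] at h
  have hsq : ((-1 : ℂ) ^ n) * ((-1 : ℂ) ^ n) = 1 := by
    rw [← pow_add, ← two_mul, pow_mul, neg_one_sq, one_pow]
  have hneg : ⟪(x : H), D x⟫_ℂ = -⟪(x : H), D x⟫_ℂ := by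
    calc ⟪(x : H), D x⟫_ℂ = (-1 : ℂ) ^ n * -((-1 : ℂ) ^ n * ⟪(x : H), D x⟫_ℂ) := h.symm
      _ = -(((-1 : ℂ) ^ n * (-1 : ℂ) ^ n) * ⟪(x : H), D x⟫_ℂ) := by ring
      _ = -⟪(x : H), D x⟫_ℂ := by rw [hsq, one_mul]
  rw [← hx]
  linear_combination (1 / 2 : ℂ) * hneg

/-- RH-FREE. **Eq. (9) as printed, for an even cyclic pair** (the standing hypothesis of §2.1,
p. 7 first line: "Let `(D, ξ)` be an even cyclic pair and `γ` the `ℤ/2`-grading"): the three-term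
recurrence `D ξ_n = a_{n−1} ξ_{n−1} + a_n ξ_{n+1}` with `a_n > 0` (Gram–Schmidt phases).  This is
the statement of the named fact `CCM2024_eq_9` under the additional hypothesis `IsEvenCyclicPair`
(for a general cyclic pair the diagonal term `⟪ξ_n, D ξ_n⟫ ξ_n` is present, see
`IsCyclicPair.map_cyclicBasisDom_succ`, and `CCM2024_eq_9` as typed — for all cyclic pairs — is
not a faithful transcription). [cite: ConnesConsaniMoscovici2024, §2.1 eq. (9) p. 7 (p0006:L38, L49)] -/
theorem CCM2024_eq_9_of_even
    {H : Type} [NormedAddCommGroup H] [InnerProductSpace ℂ H] [CompleteSpace H]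
    (D : H →ₗ.[ℂ] H) (ξ : H) (v : ℕ → D.domain) (hD : IsEvenCyclicPair D ξ)
    (hv : IsIterateSeq D ξ v) :
    (∀ n : ℕ, (((jacobiCoeff v n).re : ℝ) : ℂ) = jacobiCoeff v n ∧ 0 < (jacobiCoeff v n).re) ∧
    D (cyclicBasisDom v 0) = jacobiCoeff v 0 • cyclicBasis v 1 ∧
    ∀ n : ℕ, D (cyclicBasisDom v (n + 1)) =
      jacobiCoeff v n • cyclicBasis v n + jacobiCoeff v (n + 1) • cyclicBasis v (n + 2) := by
  obtain ⟨hD, γ, hγ⟩ := hD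
  refine ⟨fun n => hD.jacobiCoeff_re_pos hv n, ?_, fun n => ?_⟩
  · rw [hD.map_cyclicBasisDom_zero hv, hγ.inner_cyclicBasis_map_self hv 0, zero_smul, zero_add]
  · rw [hD.map_cyclicBasisDom_succ hv n, hγ.inner_cyclicBasis_map_self hv (n + 1), zero_smul,
      add_zero]

end Even

/-! ### Proposition 2.2: the finite-rank commutators `[D, f(N)]` and the bounds (10) -/

section Commutator

variable {H : Type*} [NormedAddCommGroup H] [InnerProductSpace ℂ H]

/-- `f(N) x = Σ_j f(j) ⟪ξ_j, x⟫ ξ_j` (eq. (8) on `c_c(ℕ)`). [cite: ConnesConsaniMoscovici2024, §2.1 eq. (8) p. 7 (p0006:L41)] -/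
theorem funcCalcN_apply (e : ℕ → H) (f : ℕ →₀ ℂ) (x : H) :
    funcCalcN e f x = ∑ j ∈ f.support, (f j * ⟪e j, x⟫_ℂ) • e j := by
  simp only [funcCalcN, Finsupp.sum, FunLike.coe_sum, Finset.sum_apply, FunLike.coe_smul,
    Pi.smul_apply, rankOne_apply, smul_smul]

/-- The support of `f` lies in `{0, …, max supp f}`. [folklore] -/
private theorem support_subset_range_sup (f : ℕ →₀ ℂ) :
    f.support ⊆ Finset.range (f.support.sup id + 1) := fun _ hj =>
  Finset.mem_range.mpr (Nat.lt_succ_of_le (Finset.le_sup (f := id) hj))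

/-- `f j = 0` beyond `max supp f`. [folklore] -/
private theorem apply_eq_zero_of_not_mem_range_sup (f : ℕ →₀ ℂ) {j : ℕ}
    (hj : j ∉ Finset.range (f.support.sup id + 1)) : f j = 0 :=
  Finsupp.notMem_support_iff.mp fun h => hj (support_subset_range_sup f h)

/-- `f (max supp f + 1) = 0`. [folklore] -/
private theorem apply_sup_succ_eq_zero (f : ℕ →₀ ℂ) : f (f.support.sup id + 1) = 0 :=
  apply_eq_zero_of_not_mem_range_sup f (by simp)

/-- The coefficient `α_j = (f(j) − f(j+1)) a_j` vanishes beyond `max supp f`. [folklore] -/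
private theorem coeff_eq_zero_of_not_mem_range_sup (f : ℕ →₀ ℂ) (a : ℕ → ℂ) {j : ℕ}
    (hj : j ∉ Finset.range (f.support.sup id + 1)) : (f j - f (j + 1)) * a j = 0 := by
  have h1 : f j = 0 := apply_eq_zero_of_not_mem_range_sup f hj
  have h2 : f (j + 1) = 0 := by
    refine apply_eq_zero_of_not_mem_range_sup f fun h => hj ?_
    rw [Finset.mem_range] at h ⊢
    omega
  rw [h1, h2, sub_zero, zero_mul]

/-- `f(N) x` as a sum over `{0, …, max supp f}`. [folklore] -/
private theorem funcCalcN_apply_eq_sum_range (e : ℕ → H) (f : ℕ →₀ ℂ) (x : H) :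
    funcCalcN e f x = ∑ j ∈ Finset.range (f.support.sup id + 1), (f j * ⟪e j, x⟫_ℂ) • e j := by
  rw [funcCalcN_apply]
  exact Finset.sum_subset (support_subset_range_sup f) fun j _ hj => by
    rw [Finsupp.notMem_support_iff.mp hj, zero_mul, zero_smul]

/-- `[D, f] x = Σ_j α_j (⟪ξ_j, x⟫ ξ_{j+1} − ⟪ξ_{j+1}, x⟫ ξ_j)`, `α_j = (f(j) − f(j+1)) a_j`. [cite: ConnesConsaniMoscovici2024, Prop. 2.2 (proof) p. 7 (p0007:L8–L22)] -/
theorem commutatorOp_apply (e : ℕ → H) (a : ℕ → ℂ) (f : ℕ →₀ ℂ) (x : H) :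
    commutatorOp e a f x = ∑ j ∈ Finset.range (f.support.sup id + 1),
      ((f j - f (j + 1)) * a j) • (⟪e j, x⟫_ℂ • e (j + 1) - ⟪e (j + 1), x⟫_ℂ • e j) := by
  simp only [commutatorOp, FunLike.coe_sum, Finset.sum_apply, FunLike.coe_smul, Pi.smul_apply,
    FunLike.coe_sub, Pi.sub_apply, rankOne_apply]

/-- The matrix coefficient `⟨ξ_{k+1} | [D,f] ξ_k⟩ = α_k` (proof of Prop. 2.2, p. 8:
"`⟨ξ_{k+1} | (Σ α_j T(j)) ξ_k⟩ = α_k`"). [cite: ConnesConsaniMoscovici2024, Prop. 2.2 (proof) p. 8 (p0007:L40)] -/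
theorem inner_basis_succ_commutatorOp_basis {e : ℕ → H} (he : Orthonormal ℂ e) (a : ℕ → ℂ)
    (f : ℕ →₀ ℂ) (k : ℕ) :
    ⟪e (k + 1), commutatorOp e a f (e k)⟫_ℂ = (f k - f (k + 1)) * a k := by
  classical
  have hite := orthonormal_iff_ite.mp he
  rw [commutatorOp_apply, inner_sum]
  have hg : ∀ j : ℕ, ⟪e (k + 1), ((f j - f (j + 1)) * a j) •
      (⟪e j, e k⟫_ℂ • e (j + 1) - ⟪e (j + 1), e k⟫_ℂ • e j)⟫_ℂ =
      if j = k then (f k - f (k + 1)) * a k else 0 := by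
    intro j
    by_cases hjk : j = k
    · subst hjk
      simp [hite, he.1]
    · by_cases h3 : j + 1 = k
      · subst h3
        have h5 : j + 1 + 1 ≠ j := by omega
        rw [inner_smul_right, inner_sub_right, inner_smul_right, inner_smul_right, hite, hite,
          hite, hite]
        simp [h5]
      · simp [hite, hjk, h3]
  rw [Finset.sum_congr rfl fun j _ => hg j, Finset.sum_ite_eq']
  split_ifs with hk
  · rfl
  · exact (coeff_eq_zero_of_not_mem_range_sup f a hk).symm

/-- RH-FREE. **Eq. (10), lower bound**: `|(f(j) − f(j+1)) a_j| ≤ ‖[D, f]‖`.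
[cite: ConnesConsaniMoscovici2024, Prop. 2.2 eq. (10) p. 8 (p0007:L48)] -/
theorem norm_coeff_le_norm_commutatorOp {e : ℕ → H} (he : Orthonormal ℂ e) (a : ℕ → ℂ)
    (f : ℕ →₀ ℂ) (k : ℕ) :
    ‖(f k - f (k + 1)) * a k‖ ≤ ‖commutatorOp e a f‖ := by
  rw [← inner_basis_succ_commutatorOp_basis he a f k]
  calc ‖⟪e (k + 1), commutatorOp e a f (e k)⟫_ℂ‖
      ≤ ‖e (k + 1)‖ * ‖commutatorOp e a f (e k)‖ := norm_inner_le_norm _ _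
    _ ≤ ‖e (k + 1)‖ * (‖commutatorOp e a f‖ * ‖e k‖) := by
        gcongr; exact ContinuousLinearMap.le_opNorm _ _
    _ = ‖commutatorOp e a f‖ := by rw [he.1, he.1, one_mul, mul_one]

omit [InnerProductSpace ℂ H] in
/-- Pythagoras for a finite pairwise orthogonal family. [folklore] -/
private theorem norm_sq_sum_of_inner_eq_zero [InnerProductSpace ℂ H] {ι : Type*} (s : Finset ι)
    (w : ι → H) (h : ∀ i ∈ s, ∀ j ∈ s, i ≠ j → ⟪w i, w j⟫_ℂ = 0) :
    ‖∑ i ∈ s, w i‖ ^ 2 = ∑ i ∈ s, ‖w i‖ ^ 2 := by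
  classical
  induction s using Finset.induction_on with
  | empty => simp
  | insert a s ha ih =>
    rw [Finset.sum_insert ha, Finset.sum_insert ha]
    have horth : ⟪w a, ∑ i ∈ s, w i⟫_ℂ = 0 := by
      rw [inner_sum]
      refine Finset.sum_eq_zero fun i hi => h a (Finset.mem_insert_self a s) i
        (Finset.mem_insert_of_mem hi) (fun hai => ha (hai ▸ hi))
    have hpy := norm_add_sq_eq_norm_sq_add_norm_sq_of_inner_eq_zero (w a) (∑ i ∈ s, w i) horth
    rw [sq, hpy, ← sq, ← sq, ih (fun i hi j hj hij => h i (Finset.mem_insert_of_mem hi) j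
      (Finset.mem_insert_of_mem hj) hij)]

/-- The block-diagonal estimate of the proof of Prop. 2.2 (p. 8): on a family of indices of one
parity the operators `T(j) = |ξ_{j+1}⟩⟨ξ_j| − |ξ_j⟩⟨ξ_{j+1}|` act on pairwise orthogonal planes, so
`‖Σ_{j ∈ S} α_j T(j) x‖ ≤ (max |α_j|) ‖x‖`. [cite: ConnesConsaniMoscovici2024, Prop. 2.2 (proof) p. 8 (p0007:L26–L30)] -/
theorem norm_sum_sameParity_le {e : ℕ → H} (he : Orthonormal ℂ e) (α : ℕ → ℂ) (x : H)
    (S : Finset ℕ) (p : ℕ) (hS : ∀ i ∈ S, i % 2 = p) {M : ℝ} (hM0 : 0 ≤ M)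
    (hM : ∀ i ∈ S, ‖α i‖ ≤ M) :
    ‖∑ i ∈ S, α i • (⟪e i, x⟫_ℂ • e (i + 1) - ⟪e (i + 1), x⟫_ℂ • e i)‖ ≤ M * ‖x‖ := by
  classical
  have hite := orthonormal_iff_ite.mp he
  set w : ℕ → H := fun i => α i • (⟪e i, x⟫_ℂ • e (i + 1) - ⟪e (i + 1), x⟫_ℂ • e i) with hw
  -- pairwise orthogonality of the `w i`, `i ∈ S`
  have horth : ∀ i ∈ S, ∀ j ∈ S, i ≠ j → ⟪w i, w j⟫_ℂ = 0 := by
    intro i hi j hj hij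
    have hpi := hS i hi
    have hpj := hS j hj
    have h1 : i + 1 ≠ j + 1 := by omega
    have h2 : i + 1 ≠ j := by omega
    have h3 : i ≠ j + 1 := by omega
    simp only [hw, inner_smul_left, inner_smul_right, inner_sub_left, inner_sub_right, hite,
      h1, h2, h3, hij, if_false, mul_zero, sub_zero]
  -- norm of each `w i`
  have hnorm : ∀ i, ‖w i‖ ^ 2 = ‖α i‖ ^ 2 * (‖⟪e i, x⟫_ℂ‖ ^ 2 + ‖⟪e (i + 1), x⟫_ℂ‖ ^ 2) := by
    intro i
    have hperp : ⟪⟪e i, x⟫_ℂ • e (i + 1), ⟪e (i + 1), x⟫_ℂ • e i⟫_ℂ = 0 := by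
      rw [inner_smul_left, inner_smul_right, hite]
      simp
    have hpy := norm_sub_sq (𝕜 := ℂ) (⟪e i, x⟫_ℂ • e (i + 1)) (⟪e (i + 1), x⟫_ℂ • e i)
    rw [hperp, map_zero, mul_zero, sub_zero, norm_smul, norm_smul, he.1, he.1, mul_one,
      mul_one] at hpy
    simp only [hw]
    rw [norm_smul, mul_pow, hpy]
  -- Pythagoras + Bessel
  have hsq : ‖∑ i ∈ S, w i‖ ^ 2 ≤ (M * ‖x‖) ^ 2 := by
    rw [norm_sq_sum_of_inner_eq_zero S w horth]
    calc ∑ i ∈ S, ‖w i‖ ^ 2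
        = ∑ i ∈ S, ‖α i‖ ^ 2 * (‖⟪e i, x⟫_ℂ‖ ^ 2 + ‖⟪e (i + 1), x⟫_ℂ‖ ^ 2) :=
          Finset.sum_congr rfl fun i _ => hnorm i
      _ ≤ ∑ i ∈ S, M ^ 2 * (‖⟪e i, x⟫_ℂ‖ ^ 2 + ‖⟪e (i + 1), x⟫_ℂ‖ ^ 2) := by
          refine Finset.sum_le_sum fun i hi => ?_
          have : ‖α i‖ ^ 2 ≤ M ^ 2 := pow_le_pow_left₀ (norm_nonneg _) (hM i hi) 2
          have h0 : 0 ≤ ‖⟪e i, x⟫_ℂ‖ ^ 2 + ‖⟪e (i + 1), x⟫_ℂ‖ ^ 2 := by positivity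
          exact mul_le_mul_of_nonneg_right this h0
      _ = M ^ 2 * (∑ i ∈ S, ‖⟪e i, x⟫_ℂ‖ ^ 2 + ∑ i ∈ S.map ⟨Nat.succ, Nat.succ_injective⟩,
            ‖⟪e i, x⟫_ℂ‖ ^ 2) := by
          rw [← Finset.mul_sum, Finset.sum_add_distrib, Finset.sum_map]
          rfl
      _ = M ^ 2 * ∑ i ∈ S ∪ S.map ⟨Nat.succ, Nat.succ_injective⟩, ‖⟪e i, x⟫_ℂ‖ ^ 2 := by
          rw [Finset.sum_union]
          rw [Finset.disjoint_left]
          intro i hi hi'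
          obtain ⟨j, hj, hji⟩ := Finset.mem_map.mp hi'
          have hpi := hS i hi
          have hpj := hS j hj
          simp only [Function.Embedding.coeFn_mk, Nat.succ_eq_add_one] at hji
          omega
      _ ≤ M ^ 2 * ‖x‖ ^ 2 := by
          gcongr
          exact he.sum_inner_products_le x
      _ = (M * ‖x‖) ^ 2 := by ring
  have h0 : 0 ≤ M * ‖x‖ := mul_nonneg hM0 (norm_nonneg _)
  exact (pow_le_pow_iff_left₀ (norm_nonneg _) h0 two_ne_zero).mp hsq

/-- RH-FREE. **Eq. (10), upper bound**: `‖[D, f]‖ ≤ 2 max_j |(f(j) − f(j+1)) a_j|` (even/odd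
splitting, p. 8: "the matrices of the terms appearing in the rhs are block diagonal").
[cite: ConnesConsaniMoscovici2024, Prop. 2.2 eq. (10) p. 8 (p0007:L48)] -/
theorem norm_commutatorOp_le {e : ℕ → H} (he : Orthonormal ℂ e) (a : ℕ → ℂ) (f : ℕ →₀ ℂ)
    {M : ℝ} (hM : ∀ j : ℕ, ‖(f j - f (j + 1)) * a j‖ ≤ M) :
    ‖commutatorOp e a f‖ ≤ 2 * M := by
  classical
  have hM0 : 0 ≤ M := (norm_nonneg _).trans (hM 0)
  refine ContinuousLinearMap.opNorm_le_bound _ (by positivity) fun x => ?_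
  rw [commutatorOp_apply]
  set R := Finset.range (f.support.sup id + 1)
  set α : ℕ → ℂ := fun j => (f j - f (j + 1)) * a j with hα
  rw [← Finset.sum_filter_add_sum_filter_not R (fun i => i % 2 = 0)]
  refine (norm_add_le _ _).trans ?_
  have h1 := norm_sum_sameParity_le he α x (R.filter fun i => i % 2 = 0) 0
    (fun i hi => (Finset.mem_filter.mp hi).2) hM0 (fun i _ => hM i)
  have h2 := norm_sum_sameParity_le he α x (R.filter fun i => ¬ i % 2 = 0) 1
    (fun i hi => by have := (Finset.mem_filter.mp hi).2; omega) hM0 (fun i _ => hM i)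
  linarith

end Commutator

/-! ### Proposition 2.2 for a cyclic pair -/

section Prop22

variable {H : Type*} [NormedAddCommGroup H] [InnerProductSpace ℂ H] [CompleteSpace H]
variable {D : H →ₗ.[ℂ] H} {ξ : H} {v : ℕ → D.domain}

omit [CompleteSpace H] in
/-- `f(N)` maps `H` into `Dom D` (its range lies in the span of finitely many `ξ_j ∈ Dom D`). [cite: ConnesConsaniMoscovici2024, Prop. 2.2 (proof) p. 7 (p0007:L4)] -/
theorem funcCalcN_cyclicBasis_mem_domain (v : ℕ → D.domain) (f : ℕ →₀ ℂ) (x : H) :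
    funcCalcN (cyclicBasis v) f x ∈ D.domain := by
  rw [funcCalcN_apply]
  exact Submodule.sum_mem _ fun j _ => Submodule.smul_mem _ _ (cyclicBasis_mem_domain v j)

/-- RH-FREE. **The commutator identity of Prop. 2.2** (display p. 7): for `x ∈ Dom D`,
`D (f(N) x) − f(N) (D x) = Σ_j (f(j) − f(j+1)) a_j (|ξ_{j+1}⟩⟨ξ_j| − |ξ_j⟩⟨ξ_{j+1}|) x`.  Valid for
every cyclic pair: the (real) diagonal Jacobi coefficients `⟪ξ_j, D ξ_j⟫` cancel because `f(N)` is
diagonal in the basis `(ξ_j)`. [cite: ConnesConsaniMoscovici2024, Prop. 2.2 (proof) p. 7 (p0007:L8–L22)] -/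
theorem IsCyclicPair.map_funcCalcN_sub (hD : IsCyclicPair D ξ) (hv : IsIterateSeq D ξ v)
    (f : ℕ →₀ ℂ) (x : D.domain) :
    D ⟨funcCalcN (cyclicBasis v) f (x : H), funcCalcN_cyclicBasis_mem_domain v f x⟩
        - funcCalcN (cyclicBasis v) f (D x) =
      commutatorOp (cyclicBasis v) (jacobiCoeff v) f (x : H) := by
  classical
  set ξ' : ℕ → H := cyclicBasis v with hξ'
  set a : ℕ → ℂ := jacobiCoeff v with ha
  set M : ℕ := f.support.sup id with hM
  set R : Finset ℕ := Finset.range (M + 1) with hR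
  set c : ℕ → ℂ := fun j => f j * ⟪ξ' j, (x : H)⟫_ℂ with hc
  set b : ℕ → ℂ := fun j => ⟪ξ' j, (D (cyclicBasisDom v j) : H)⟫_ℂ with hb
  set T : ℕ → H := fun j => ⟪ξ' j, (x : H)⟫_ℂ • ξ' (j + 1) - ⟪ξ' (j + 1), (x : H)⟫_ℂ • ξ' j
    with hT
  have hfM : f (M + 1) = 0 := apply_sup_succ_eq_zero f
  -- `f(N) y` as a sum over `R`
  have hF : ∀ y : H, funcCalcN ξ' f y = ∑ j ∈ R, (f j * ⟪ξ' j, y⟫_ℂ) • ξ' j := fun y =>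
    funcCalcN_apply_eq_sum_range ξ' f y
  -- `D (f(N) x) = Σ_j c_j D ξ_j`
  have hDF : (D ⟨funcCalcN ξ' f (x : H), funcCalcN_cyclicBasis_mem_domain v f x⟩ : H) =
      ∑ j ∈ R, c j • (D (cyclicBasisDom v j) : H) := by
    have heq : (⟨funcCalcN ξ' f (x : H), funcCalcN_cyclicBasis_mem_domain v f x⟩ : D.domain) =
        ∑ j ∈ R, c j • cyclicBasisDom v j := by
      apply Subtype.ext
      show funcCalcN ξ' f (x : H) = ((∑ j ∈ R, c j • cyclicBasisDom v j : D.domain) : H)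
      rw [Submodule.coe_sum, hF]
      exact Finset.sum_congr rfl fun j _ => rfl
    rw [heq, ← LinearPMap.toFun_eq_coe, map_sum]
    simp only [map_smul, LinearPMap.toFun_eq_coe]
  -- the three-term recurrence, uniformly in `j`
  set A : ℕ → H := fun j => match j with
    | 0 => 0
    | k + 1 => a k • ξ' k with hA
  have hrec : ∀ j, (D (cyclicBasisDom v j) : H) = A j + b j • ξ' j + a j • ξ' (j + 1) := by
    intro j
    cases j with
    | zero => rw [show A 0 = 0 from rfl, zero_add]; exact hD.map_cyclicBasisDom_zero hv
    | succ k => exact hD.map_cyclicBasisDom_succ hv k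
  have hbreal : ∀ j, conj (b j) = b j := fun j => hD.conj_inner_cyclicBasis_map_self j
  have hareal : ∀ j, conj (a j) = a j := fun j => hD.conj_jacobiCoeff hv j
  have hinner : ∀ j, ⟪ξ' j, (D x : H)⟫_ℂ =
      ⟪A j, (x : H)⟫_ℂ + b j * ⟪ξ' j, (x : H)⟫_ℂ + a j * ⟪ξ' (j + 1), (x : H)⟫_ℂ := by
    intro j
    have h1 : ⟪ξ' j, (D x : H)⟫_ℂ = ⟪(D (cyclicBasisDom v j) : H), (x : H)⟫_ℂ :=
      hD.inner_map_right (cyclicBasisDom v j) x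
    rw [h1, hrec j, inner_add_left, inner_add_left, inner_smul_left, inner_smul_left, hbreal,
      hareal]
  have hinnerA : ∀ k, ⟪A (k + 1), (x : H)⟫_ℂ = a k * ⟪ξ' k, (x : H)⟫_ℂ := fun k => by
    show ⟪a k • ξ' k, (x : H)⟫_ℂ = _
    rw [inner_smul_left, hareal]
  -- pointwise identity for the summands
  set Φ : ℕ → H := fun j => c j • A j - (f j * ⟪A j, (x : H)⟫_ℂ) • ξ' j with hΦ
  have hpoint : ∀ j, c j • (D (cyclicBasisDom v j) : H) - (f j * ⟪ξ' j, (D x : H)⟫_ℂ) • ξ' j =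
      Φ j + (f j * a j) • T j := by
    intro j
    rw [hrec j, hinner j]
    simp only [hΦ, hT, hc]
    module
  have hΦ0 : Φ 0 = 0 := by
    simp only [hΦ]
    rw [show A 0 = 0 from rfl, inner_zero_left, mul_zero, zero_smul, smul_zero, sub_zero]
  have hΦsucc : ∀ k, Φ (k + 1) = -((f (k + 1) * a k) • T k) := by
    intro k
    simp only [hΦ, hT, hc]
    rw [hinnerA k, show A (k + 1) = a k • ξ' k from rfl]
    module
  -- assemble
  rw [hDF, hF (D x), commutatorOp_apply, ← Finset.sum_sub_distrib]
  calc ∑ j ∈ R, (c j • (D (cyclicBasisDom v j) : H) - (f j * ⟪ξ' j, (D x : H)⟫_ℂ) • ξ' j)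
      = ∑ j ∈ R, (Φ j + (f j * a j) • T j) := Finset.sum_congr rfl fun j _ => hpoint j
    _ = ∑ j ∈ R, Φ j + ∑ j ∈ R, (f j * a j) • T j := Finset.sum_add_distrib
    _ = -∑ j ∈ R, (f (j + 1) * a j) • T j + ∑ j ∈ R, (f j * a j) • T j := by
        congr 1
        rw [hR, Finset.sum_range_succ', hΦ0, add_zero, Finset.sum_range_succ (fun j =>
          (f (j + 1) * a j) • T j), hfM, zero_mul, zero_smul, add_zero, ← Finset.sum_neg_distrib]
        exact Finset.sum_congr rfl fun k _ => hΦsucc k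
    _ = ∑ j ∈ R, ((f j - f (j + 1)) * a j) • T j := by
        rw [← Finset.sum_neg_distrib, ← Finset.sum_add_distrib]
        refine Finset.sum_congr rfl fun j _ => ?_
        module

/-- RH-FREE. **Proposition 2.2** (discharge of the named fact `CCM2024_prop_2_2`): for every cyclic
pair and `f ∈ c_c(ℕ)`, `f(N)` maps `Dom D` into `Dom D`, `[D, f(N)]` is the finite-rank operator
`Σ_j (f(j) − f(j+1)) a_j (|ξ_{j+1}⟩⟨ξ_j| − |ξ_j⟩⟨ξ_{j+1}|)`, and (eq. (10))
`max_j |(f(j) − f(j+1)) a_j| ≤ ‖[D, f]‖ ≤ 2 max_j |(f(j) − f(j+1)) a_j|`.  Printed proof, p. 7–8.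
[cite: ConnesConsaniMoscovici2024, Prop. 2.2 & eq. (10) p. 7–8 (p0006:L44, p0007:L8–L48)] -/
theorem CCM2024_prop_2_2_holds : CCM2024_prop_2_2 := by
  intro H _ _ _ D ξ v hD hv f
  refine ⟨fun x => ⟨funcCalcN_cyclicBasis_mem_domain v f x, hD.map_funcCalcN_sub hv f x⟩,
    fun j => norm_coeff_le_norm_commutatorOp (hD.orthonormal_cyclicBasis hv) _ f j,
    fun M hM => norm_commutatorOp_le (hD.orthonormal_cyclicBasis hv) _ f hM⟩

end Prop22

/-! ### Proposition 2.3: the spectral distance on `ℕ` (corrected indexing)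

As printed, Prop. 2.3 / eq. (11) reads `½ d(n,m) ≤ sup{|f(n) − f(m)| : ‖[D,f]‖ ≤ 1} ≤ d(n,m)` with
`d(n,m) = |φ(n) − φ(m)|`, `φ(n) := Σ_{0 ≤ j ≤ n} a_j⁻¹`; its proof says "the distance `d(n,m)` is
given by `sup{|f(n) − f(m)| : max |(f(j) − f(j+1)) a_j| ≤ 1}`".  That supremum is
`Σ_{m ≤ j < n} a_j⁻¹ = φ(n−1) − φ(m−1)` (telescoping `f(m) − f(n) = Σ_{m ≤ j < n} (f(j) − f(j+1))`),
not `φ(n) − φ(m) = Σ_{m < j ≤ n} a_j⁻¹`: the printed `φ` is off by one index.  (For the archimedean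
pair of §3, `a_n = |α_n| = ½ √((2n+1)(2n+2))` is increasing and already `f = c δ_0` gives
`|f(0) − f(1)| = 1/a_0 > 1/a_1 = d(1,0)` at `‖[D,f]‖ = 1`, violating the printed upper bound.)  We
prove the statement with the corrected `φ̃(n) := Σ_{0 ≤ j < n} a_j⁻¹` (so `φ̃(n+1) = spectralPhi a n`),
following the printed proof (eq. (10)). -/

section Prop23

variable {H : Type*} [NormedAddCommGroup H] [InnerProductSpace ℂ H] [CompleteSpace H]
variable {D : H →ₗ.[ℂ] H} {ξ : H} {v : ℕ → D.domain}

/-- `a_n ≠ 0`. [cite: ConnesConsaniMoscovici2024, §2.1 eq. (9) p. 7 (p0006:L49)] -/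
theorem IsCyclicPair.jacobiCoeff_ne_zero (hD : IsCyclicPair D ξ) (hv : IsIterateSeq D ξ v) (n : ℕ) :
    jacobiCoeff v n ≠ 0 := by
  intro h
  have := (hD.jacobiCoeff_re_pos hv n).2
  rw [h, Complex.zero_re] at this
  exact lt_irrefl 0 this

omit [CompleteSpace H] in
/-- `φ̃(n+1) = φ(n)`: the corrected potential is the printed `spectralPhi` shifted by one. [folklore] -/
private theorem sum_range_succ_inv_norm_eq_spectralPhi (a : ℕ → ℂ) (n : ℕ) :
    ∑ j ∈ Finset.range (n + 1), ‖a j‖⁻¹ = spectralPhi a n := rfl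

/-- Prop. 2.3 (corrected), the case `m ≤ n`, with `d̃(n,m) = Σ_{m ≤ j < n} a_j⁻¹`. [cite: ConnesConsaniMoscovici2024, Prop. 2.3 eq. (11) p. 8 (p0007:L52–L60)] -/
theorem IsCyclicPair.spectralDistance_bounds_of_le (hD : IsCyclicPair D ξ) (hv : IsIterateSeq D ξ v)
    {m n : ℕ} (hmn : m ≤ n) :
    let d : ℝ := ∑ j ∈ Finset.Ico m n, ‖jacobiCoeff v j‖⁻¹
    let S : Set ℝ := {r | ∃ f : ℕ →₀ ℂ,
      ‖commutatorOp (cyclicBasis v) (jacobiCoeff v) f‖ ≤ 1 ∧ r = ‖f n - f m‖}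
    d / 2 ≤ sSup S ∧ sSup S ≤ d := by
  classical
  intro d S
  have hon := hD.orthonormal_cyclicBasis hv
  set a : ℕ → ℂ := jacobiCoeff v with ha
  have hane : ∀ j, a j ≠ 0 := fun j => hD.jacobiCoeff_ne_zero hv j
  -- upper bound for every admissible `f`
  have hupper : ∀ r ∈ S, r ≤ d := by
    rintro r ⟨f, hf, rfl⟩
    have hstep : ∀ j, ‖f j - f (j + 1)‖ ≤ ‖a j‖⁻¹ := by
      intro j
      have h1 : ‖(f j - f (j + 1)) * a j‖ ≤ 1 :=
        (norm_coeff_le_norm_commutatorOp hon a f j).trans hf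
      have hpos : 0 < ‖a j‖ := norm_pos_iff.mpr (hane j)
      rw [norm_mul] at h1
      calc ‖f j - f (j + 1)‖ = ‖f j - f (j + 1)‖ * ‖a j‖ * ‖a j‖⁻¹ := by
            rw [mul_assoc, mul_inv_cancel₀ hpos.ne', mul_one]
        _ ≤ 1 * ‖a j‖⁻¹ := by gcongr
        _ = ‖a j‖⁻¹ := one_mul _
    have htel : f m - f n = ∑ j ∈ Finset.Ico m n, (f j - f (j + 1)) := by
      rw [Finset.sum_Ico_eq_sub _ hmn, Finset.sum_range_sub', Finset.sum_range_sub']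
      ring
    calc ‖f n - f m‖ = ‖f m - f n‖ := norm_sub_rev _ _
      _ = ‖∑ j ∈ Finset.Ico m n, (f j - f (j + 1))‖ := by rw [htel]
      _ ≤ ∑ j ∈ Finset.Ico m n, ‖f j - f (j + 1)‖ := norm_sum_le _ _
      _ ≤ d := Finset.sum_le_sum fun j _ => hstep j
  have hne : S.Nonempty := ⟨‖(0 : ℕ →₀ ℂ) n - (0 : ℕ →₀ ℂ) m‖, 0, by
    refine ⟨?_, rfl⟩
    have h := norm_commutatorOp_le hon a (0 : ℕ →₀ ℂ) (M := 0) (fun j => by simp)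
    linarith⟩
  have hbdd : BddAbove S := ⟨d, hupper⟩
  refine ⟨?_, csSup_le hne hupper⟩
  -- lower bound: an explicit test sequence
  set gr : ℕ → ℝ := fun j => if j < n then (1 / 2) * ∑ k ∈ Finset.Ico j n, ‖a k‖⁻¹ else 0
    with hgr
  set g : ℕ → ℂ := fun j => ((gr j : ℝ) : ℂ) with hg
  have hgsupp : Function.support g ⊆ ↑(Finset.range n) := by
    intro j hj
    rw [Function.mem_support] at hj
    by_contra hjn
    apply hj
    have : ¬ j < n := fun h => hjn (Finset.mem_coe.mpr (Finset.mem_range.mpr h))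
    simp only [hg, hgr, this, if_false, Complex.ofReal_zero]
  set f : ℕ →₀ ℂ := Finsupp.ofSupportFinite g ((Finset.range n).finite_toSet.subset hgsupp)
    with hfdef
  have hf : ∀ j, f j = ((gr j : ℝ) : ℂ) := fun j => by
    rw [hfdef, Finsupp.ofSupportFinite_coe]
  have hdiffr : ∀ j, gr j - gr (j + 1) = if j < n then (1 / 2) * ‖a j‖⁻¹ else 0 := by
    intro j
    simp only [hgr]
    by_cases hj : j < n
    · rw [if_pos hj, if_pos hj]
      by_cases hj1 : j + 1 < n
      · rw [if_pos hj1, Finset.sum_eq_sum_Ico_succ_bot hj]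
        ring
      · have hjn : j + 1 = n := by omega
        rw [if_neg hj1, ← hjn, Nat.Ico_succ_singleton, Finset.sum_singleton, sub_zero]
    · have hj1 : ¬ j + 1 < n := by omega
      rw [if_neg hj, if_neg hj1, sub_zero, if_neg hj]
  have hcoef : ∀ j, ‖(f j - f (j + 1)) * a j‖ ≤ 1 / 2 := by
    intro j
    rw [hf, hf, ← Complex.ofReal_sub, hdiffr, norm_mul, Complex.norm_real, Real.norm_eq_abs]
    split_ifs with hj
    · have hpos : 0 < ‖a j‖ := norm_pos_iff.mpr (hane j)
      rw [abs_of_nonneg (by positivity), mul_assoc, inv_mul_cancel₀ hpos.ne', mul_one]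
    · simp
  have hC : ‖commutatorOp (cyclicBasis v) a f‖ ≤ 1 := by
    have h := norm_commutatorOp_le hon a f hcoef
    linarith
  have hval : ‖f n - f m‖ = d / 2 := by
    rw [hf, hf, ← Complex.ofReal_sub, Complex.norm_real, Real.norm_eq_abs]
    simp only [hgr, lt_irrefl, if_false, zero_sub, abs_neg]
    by_cases hm : m < n
    · rw [if_pos hm, abs_of_nonneg (by positivity)]
      show 1 / 2 * ∑ k ∈ Finset.Ico m n, ‖a k‖⁻¹ = d / 2
      ring
    · have hmn' : m = n := le_antisymm hmn (not_lt.mp hm)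
      rw [if_neg hm, abs_zero]
      show (0 : ℝ) = d / 2
      simp only [d, hmn', Finset.Ico_self, Finset.sum_empty, zero_div]
  exact le_csSup hbdd ⟨f, hC, hval.symm⟩

/-- RH-FREE. **Proposition 2.3 with corrected indexing**: for every cyclic pair and `n, m ∈ ℕ`,
with `φ̃(n) := Σ_{0 ≤ j < n} a_j⁻¹` and `d̃(n,m) := |φ̃(n) − φ̃(m)|`,
`½ d̃(n,m) ≤ sup {|f(n) − f(m)| : f ∈ c_c(ℕ), ‖[D, f]‖ ≤ 1} ≤ d̃(n,m)`,
so the spectral distance of `(c_0(ℕ), H, D)` on `ℕ` is equivalent to `d̃`.  The printed statement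
(typed verbatim as the named fact `CCM2024_prop_2_3`) uses `φ(n) = Σ_{0 ≤ j ≤ n} a_j⁻¹ = φ̃(n+1)`
instead, an index slip (see the section docstring); the printed proof (from eq. (10)) proves
exactly the present statement. [cite: ConnesConsaniMoscovici2024, Prop. 2.3 eq. (11) p. 8 (p0007:L52–L60)] -/
theorem CCM2024_prop_2_3_corrected
    {H : Type} [NormedAddCommGroup H] [InnerProductSpace ℂ H] [CompleteSpace H]
    (D : H →ₗ.[ℂ] H) (ξ : H) (v : ℕ → D.domain) (hD : IsCyclicPair D ξ)
    (hv : IsIterateSeq D ξ v) (n m : ℕ) :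
    let d : ℝ := |∑ j ∈ Finset.range n, ‖jacobiCoeff v j‖⁻¹ -
      ∑ j ∈ Finset.range m, ‖jacobiCoeff v j‖⁻¹|
    let S : Set ℝ := {r | ∃ f : ℕ →₀ ℂ,
      ‖commutatorOp (cyclicBasis v) (jacobiCoeff v) f‖ ≤ 1 ∧ r = ‖f n - f m‖}
    d / 2 ≤ sSup S ∧ sSup S ≤ d := by
  intro d S
  rcases le_total m n with hmn | hnm
  · have hd : d = ∑ j ∈ Finset.Ico m n, ‖jacobiCoeff v j‖⁻¹ := by
      simp only [d]
      rw [← Finset.sum_Ico_eq_sub _ hmn, abs_of_nonneg (Finset.sum_nonneg fun j _ => by positivity)]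
    rw [hd]
    exact hD.spectralDistance_bounds_of_le hv hmn
  · have hd : d = ∑ j ∈ Finset.Ico n m, ‖jacobiCoeff v j‖⁻¹ := by
      simp only [d]
      rw [abs_sub_comm, ← Finset.sum_Ico_eq_sub _ hnm,
        abs_of_nonneg (Finset.sum_nonneg fun j _ => by positivity)]
    have hS : S = {r | ∃ f : ℕ →₀ ℂ,
        ‖commutatorOp (cyclicBasis v) (jacobiCoeff v) f‖ ≤ 1 ∧ r = ‖f m - f n‖} := by
      ext r
      simp only [S, Set.mem_setOf_eq, norm_sub_rev (_ : ℂ)]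
    rw [hd, hS]
    exact hD.spectralDistance_bounds_of_le hv hnm

end Prop23

end Literature.NumberTheory.ConnesConsani2024
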